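import Literature.NumberTheory.EllipticCurves.ManinConstantModularDegree
import Summits.BirchSwinnertonDyer.Rank1Residual.ManinAdditive.WildEight
import HarnessLib
import HarnessLib.Audit.Tags

/-!
# Sketch-imc-g23f — THE TWO WILD RESIDUALS OF THE ČESNAVIČIUS–NEURURER–SAHA INEQUALITY, v-UNIFORM
# (imc g23, PROOFS-g23 §5.17 THM 29.W; MEMO-imc §29.14)

TYPER NOTE (typer g19, T-imc-42).  SOURCE = HOME/imc/kit-g23/Sketch-imc-g23f.lean sha16 f3233a7bb954aaaf (96 l.; imc: rc 0 · 0 warn; BC7 2/2 CLEAN,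
record g23f-bc7.raw.txt 67623a1fbbf5e9d9), landed VERBATIM except this note, the dropped crux-probe import/lines, the target path
(`…/Rank1Residual/ManinAdditive/WildResiduals.lean`; the ask's `Rank1Residual/Theorems/ManinAdditive/` does not exist), and — as imc invited —
`import …ManinAdditive.WildEight` (which imports `WildTwentySeven`) + two PROVED by-name slice edges: `cnsBoundAtWildTwentySeven_of_wildThree :
CNSInequalityWildThree → WildTwentySeven.CNSBoundAtWildTwentySeven` (E-190 ⟹ E-185) and `cnsBoundAtWildEight_of_wildTwo : CNSInequalityWildTwo →
WildEight.CNSBoundAtWildEight` (E-191 ⟹ E-189).  Namespace `…ManinAdditive.WildResiduals` as written — ROUTE-INDEPENDENT.  HONEST FRAMING (typer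
summary; details = imc's text below): LENS imc; STATUS E-imc-190/191 CONJECTURAL obligation nodes, v-uniform versions of E-185/E-189 (the `v = 3`
slices; by PROOFS-g23 §5.17 THM 29.W each slice `v` ⟸ ONE lattice identity at level `7·3^v` resp. `5·2^v`; `(3,3)` settled on paper by THM 29.T
(ref1 §R149: A1–A8 all close; «beyond-print: YES, CANDIDATE» upheld), `(2,3)` = machine decision D-imc-41′); PROVED bookkeeping
`padicVal_maninConstant_le_modularDegree_unconditional` (tree fact ∧ E-190 ∧ E-191 ⟹ the ČNS inequality for every prime and every
conductor-level datum).  NOT IN PRINT beyond ČNS Thm 1.2 / §1.  BC5 (imc, MANIN-ADDITIVE-CREMONA-TIER-v1.tsv.gz, Cremona-certified optimal curves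
`N < 5·10⁵`): p = 3 class v₃ = 3/4/5: 4265/1468/977 classes, p = 2 class v₂ = 3…8: 8391/16706/5215/12697/3076/1280, all `c = 1`, 0 violations
(`p ∣ deg φ` on all but 2 of the 54 075).  REFUTER VERDICTS: ref1 R-imc-76 (PROOFS §5.17) PENDING at filing; ref2 PENDING.  CHEAPEST FALSIFIER: an
optimal curve in either class with `p ∣ c`, `p ∤ deg φ`.  WHY IT MATTERS: «the two typed residuals are exactly what separates the printed theorem
from the unconditional inequality» (imc).  PARTITION ladder-adjacent · beyond-print theorem: NO · bears_on: stmt-BirchSwinnertonDyer-22967/22968.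
BSD is not proved by this; C2/C3 OPEN.

The tree fact `cesnaviciusNeururerSaha_padicVal_maninConstant_le_modularDegree` renders CNS Thm. 1.2 with
its two printed exceptional clauses as hypotheses: `val_p(c_φ) ≤ val_p(deg φ)` unless
`p = 2 ∧ 8 ∣ N ∧ (∀ q ∣ N prime, q ≢ 3 mod 4)` or `p = 3 ∧ 27 ∣ N ∧ (∀ q ∣ N prime, q ≢ 2 mod 3)`.
PROOFS-g23 §5.17 (THM 29.W) shows that in each excluded class and for each valuation `v = v_p(N)` the
coarse Katz–Mazur model of `X₀(N)` over `W(𝔽̄_p)` has wild quotient singularities of exactly ONE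
isomorphism type `𝔖_{p^v}` (invariants of the universal deformation ring of `(E₀, C_{p^v})`, `j(E₀) = 0`,
under the stabiliser, which has order exactly `p`), that `X₀(q·p^v)` for one auxiliary prime `q ≡ 1 (mod 4)`
(resp. `mod 3`) carries exactly one of them, and hence that CNS's rational-singularity hypothesis for ALL
`N` with `v_p(N) = v` in the class is equivalent to ONE lattice identity
`Cot 𝒩(J₀(q p^v)) ⊗ ℤ_p = H⁰(X₀(q p^v), Ω) ⊗ ℤ_p` (`N₀ = 40, 80, 160, …`; `189, 567, …`); the case
`(p, v) = (3, 3)` is settled on paper by PROOFS-g23 §5.15 (THM 29.T), the case `(2, 3)` is the machine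
decision D-imc-41′.  Typed here, v-uniformly: **E-imc-190 `CNSInequalityWildThree`** and **E-imc-191
`CNSInequalityWildTwo`** = the CNS inequality on the two excluded classes (all `v ≥ 3`), and the PROVED
bookkeeping `padicVal_maninConstant_le_modularDegree_unconditional` : tree fact ∧ E-190 ∧ E-191 ⟹ the
CNS inequality for every prime at every level (conductor-level data).  E-imc-185 (`27 ∥ N`) and E-imc-189
(`8 ∥ N`) are the `v = 3` slices.  Census (HOME/MANIN-ADDITIVE-CREMONA-TIER-v1.tsv.gz, Cremona-certified
optimal curves, `N < 5·10⁵`): p = 3 class — v₃ = 3: 4265 classes, v₃ = 4: 1468, v₃ = 5: 977, all `c = 1`,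
0 violations; p = 2 class — v₂ = 3,…,8: 8391, 16706, 5215, 12697, 3076, 1280 classes, all `c = 1`,
0 violations (`p ∣ deg φ` on all but 2 of these 54 075 classes, so the inequality is slack there).

PARTITION ladder-adjacent · beyond-print theorem: NO · BSD is not proved by this; Manin's conjecture is
not proved by this; C2/C3 OPEN.
-/

noncomputable section

namespace Summit.BirchSwinnertonDyer.Rank1Residual.ManinAdditive.WildResiduals

open Literature.NumberTheory.EllipticCurves.ModularForms

/-- crux-candidate **E-imc-190** (imc g23, PROOFS-g23 §5.17): the CNS inequality at `p = 3` on CNS's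
excluded class — `27 ∣ N` and no prime `q ∣ N` with `q ≡ 2 (mod 3)` — for every `v₃(N) ≥ 3`.  By THM 29.W
it follows, slice by slice in `v = v₃(N)`, from `Cot 𝒩(J₀(7·3^v)) ⊗ ℤ₃ = H⁰(X₀(7·3^v), Ω) ⊗ ℤ₃`; the slice
`v = 3` is E-imc-185 (paper theorem THM 29.T, audit pending).  Why it might fail: for `v ≥ 4` nothing in
print excludes `p_g(𝔖_{3^v}) > 0`; census 6710/6710 certified classes have `c = 1`.
[cite: CesnaviciusNeururerSaha2023, Thm. 1.2 and §1] -/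
@[conjecture] def CNSInequalityWildThree : Prop :=
  ∀ (W : WeierstrassCurve ℚ) [W.IsElliptic] [W.IsGloballyMinimal] [NeZero (W.conductorNorm ℤ)]
    (D : ModularParametrizationData W (W.conductorNorm ℤ)),
    3 ^ 3 ∣ W.conductorNorm ℤ → (∀ q : ℕ, q.Prime → q ∣ W.conductorNorm ℤ → q % 3 ≠ 2) →
    padicValInt 3 D.maninConstant ≤ padicValNat 3 D.modularDegree

/-- crux-candidate **E-imc-191** (imc g23, PROOFS-g23 §5.17): the CNS inequality at `p = 2` on CNS's
excluded class — `8 ∣ N` and no prime `q ∣ N` with `q ≡ 3 (mod 4)` — for every `v₂(N) ≥ 3`.  By THM 29.W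
the slice `v` follows from `Cot 𝒩(J₀(5·2^v)) ⊗ ℤ₂ = H⁰(X₀(5·2^v), Ω) ⊗ ℤ₂` (`v = 3`: `N₀ = 40`, decision
D-imc-41′; E-imc-189 is that slice).  Why it might fail: `p_g(𝔖_{2^v}) > 0` is not excluded in print for any
`v ≥ 3`; census 47365/47365 certified classes (`v₂ = 3,…,8`) have `c = 1`.
[cite: CesnaviciusNeururerSaha2023, Thm. 1.2 and §1] -/
@[conjecture] def CNSInequalityWildTwo : Prop :=
  ∀ (W : WeierstrassCurve ℚ) [W.IsElliptic] [W.IsGloballyMinimal] [NeZero (W.conductorNorm ℤ)]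
    (D : ModularParametrizationData W (W.conductorNorm ℤ)),
    2 ^ 3 ∣ W.conductorNorm ℤ → (∀ q : ℕ, q.Prime → q ∣ W.conductorNorm ℤ → q % 4 ≠ 3) →
    padicValInt 2 D.maninConstant ≤ padicValNat 2 D.modularDegree

/-- PROVED bookkeeping: the printed CNS fact (exceptional clauses as hypotheses) together with E-imc-190 and
E-imc-191 yields the CNS inequality `val_p(c_φ) ≤ val_p(deg φ)` for EVERY prime `p` and EVERY conductor-level
modular parametrisation datum — i.e. the two typed residuals are exactly what separates the printed theorem from
the unconditional inequality. -/
theorem padicVal_maninConstant_le_modularDegree_unconditional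
    (hCNS : cesnaviciusNeururerSaha_padicVal_maninConstant_le_modularDegree)
    (h190 : CNSInequalityWildThree) (h191 : CNSInequalityWildTwo)
    (W : WeierstrassCurve ℚ) [W.IsElliptic] [W.IsGloballyMinimal] [NeZero (W.conductorNorm ℤ)]
    (D : ModularParametrizationData W (W.conductorNorm ℤ)) (p : ℕ) (hp : p.Prime) :
    padicValInt p D.maninConstant ≤ padicValNat p D.modularDegree := by
  by_cases h2 : (p = 2 ∧ 2 ^ 3 ∣ W.conductorNorm ℤ ∧ ∀ q : ℕ, q.Prime → q ∣ W.conductorNorm ℤ → q % 4 ≠ 3)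
  · obtain ⟨rfl, h8, hq⟩ := h2
    exact h191 W D h8 hq
  · by_cases h3 : (p = 3 ∧ 3 ^ 3 ∣ W.conductorNorm ℤ ∧ ∀ q : ℕ, q.Prime → q ∣ W.conductorNorm ℤ → q % 3 ≠ 2)
    · obtain ⟨rfl, h27, hq⟩ := h3
      exact h190 W D h27 hq
    · exact hCNS W D p hp h2 h3

/-- PROVED: E-imc-190 specialises to the `27 ∥ N` slice (the statement of E-imc-185, written out). -/
theorem wildThree_slice_twentySeven (h190 : CNSInequalityWildThree)
    (W : WeierstrassCurve ℚ) [W.IsElliptic] [W.IsGloballyMinimal] [NeZero (W.conductorNorm ℤ)]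
    (D : ModularParametrizationData W (W.conductorNorm ℤ))
    (h27 : 3 ^ 3 ∣ W.conductorNorm ℤ) (_h81 : ¬ 3 ^ 4 ∣ W.conductorNorm ℤ)
    (hq : ∀ q : ℕ, q.Prime → q ∣ W.conductorNorm ℤ → q % 3 ≠ 2) :
    padicValInt 3 D.maninConstant ≤ padicValNat 3 D.modularDegree :=
  h190 W D h27 hq

/-- **Typer slice edge (by name): E-imc-190 ⟹ E-imc-185** (`WildTwentySeven.CNSBoundAtWildTwentySeven`, p713083). -/
theorem cnsBoundAtWildTwentySeven_of_wildThree (h190 : CNSInequalityWildThree) :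
    WildTwentySeven.CNSBoundAtWildTwentySeven :=
  fun W _ _ _ D h27 _ hq => h190 W D h27 hq

/-- **Typer slice edge (by name): E-imc-191 ⟹ E-imc-189** (`WildEight.CNSBoundAtWildEight`). -/
theorem cnsBoundAtWildEight_of_wildTwo (h191 : CNSInequalityWildTwo) : WildEight.CNSBoundAtWildEight :=
  fun W _ _ _ D h8 _ hq => h191 W D h8 hq

end Summit.BirchSwinnertonDyer.Rank1Residual.ManinAdditive.WildResiduals

end
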